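import Literature.Barriers.AtomisticToContinuum.OneDimensionalHardCoreProofs
import HarnessLib

/-!
# Hard rods, Part F′: the adjugate bound for non-Hermitian contractions

`Literature/Barriers/AtomisticToContinuum/` (D-0021 barrier catalogue), sub-problem
`BoseEinsteinCondensation`; first file of the typed proof of the rod barrier `OneDimensionalHardRods`
(`OneDimensionalHardCoreRods.lean`, eighth audit of `OneDimensionalHardCore`, 2026-08-16).

For rods of positive diameter Lenard's cofactor formula holds with a NON-Hermitian one-body
matrix `A(t)` (the crossed fermions are translated by the rod length), a compression of a
contraction. Part F of `OneDimensionalHardCoreProofs.lean`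
(`norm_star_dotProduct_adjugate_mulVec_le`) bounds `|⟨x, adj(M) y⟩|` for HERMITIAN `M`; here we
deduce the version for an arbitrary contraction `A` (`‖Av‖ ≤ ‖v‖`):

`|⟨x, adj(A) y⟩| ≤ e^{1/4} · exp((‖A‖²_HS − N)/4) · ‖x‖ ‖y‖`

(`norm_star_dotProduct_adjugate_mulVec_le_of_contraction`). Proof: `adj(A)ᴴ adj(A) = adj(A Aᴴ)`,
so `‖adj(A) y‖² = ⟨y, adj(AAᴴ) y⟩` is controlled by Part F for the Hermitian `AAᴴ`, whose
`tr (AAᴴ)² = ‖AAᴴ‖²_HS ≤ ‖Aᴴ‖²_HS = ‖A‖²_HS` because `A` is a contraction; then Cauchy–Schwarz.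
(Paper version: `‖adj A‖ = ∏_{k<N} s_k ≤ e^{1/2}exp((∑s_k² − N)/2)` by `s ≤ e^{(s²−1)/2}`; the
route through `AAᴴ` costs a factor `2` in the exponent, immaterial downstream.)

## References

* [ForresterEtAl2003] P. J. Forrester et al., Phys. Rev. A 67 (2003) 043607, §2.1.2 (Lenard's
  determinant formula, whose cofactor form these bounds serve).
* [MazzantiEtAl2008] F. Mazzanti et al., Phys. Rev. Lett. 100 (2008) 020401, Eqs. (2)–(3) (rods).
-/

noncomputable section

open Finset Complex Matrix
open scoped BigOperators ComplexConjugate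

namespace Literature.Barriers.AtomisticToContinuum.BoseGas

section AdjugateContraction

variable {m : Type*} [Fintype m] [DecidableEq m]

omit [DecidableEq m] in
/-- For a Hermitian matrix, `re tr(H²) = ∑_{i,j} ‖H i j‖²` (the squared Hilbert–Schmidt norm).
[folklore] -/
theorem re_trace_mul_self_of_isHermitian {H : Matrix m m ℂ} (hH : H.IsHermitian) :
    Complex.re ((H * H).trace) = ∑ i, ∑ j, ‖H i j‖ ^ 2 := by
  simp only [Matrix.trace, Matrix.diag, Matrix.mul_apply, Complex.re_sum]
  refine Finset.sum_congr rfl fun i _ => Finset.sum_congr rfl fun j _ => ?_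
  rw [← hH.apply j i, Complex.star_def, mul_conj_eq_norm_sq, Complex.ofReal_re]

/-- The squared Hilbert–Schmidt norm as a sum over the standard basis: `∑_{i,j}‖M i j‖² =
∑_j ∑_i ‖(M e_j) i‖²`. [folklore] -/
theorem sum_norm_sq_entries_eq_sum_mulVec_single (M : Matrix m m ℂ) :
    ∑ i, ∑ j, ‖M i j‖ ^ 2 = ∑ j, ∑ i, ‖(M *ᵥ Pi.single j 1) i‖ ^ 2 := by
  rw [Finset.sum_comm]
  refine Finset.sum_congr rfl fun j _ => Finset.sum_congr rfl fun i _ => ?_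
  rw [mulVec_single_one]
  rfl

omit [DecidableEq m] in
/-- Entries of the conjugate transpose have the same norms, transposed. [folklore] -/
theorem sum_norm_sq_entries_conjTranspose (A : Matrix m m ℂ) :
    ∑ i, ∑ j, ‖Aᴴ i j‖ ^ 2 = ∑ i, ∑ j, ‖A i j‖ ^ 2 := by
  rw [Finset.sum_comm]
  refine Finset.sum_congr rfl fun i _ => Finset.sum_congr rfl fun j _ => ?_
  rw [conjTranspose_apply, norm_star]

/-- For a contraction `A`, `tr (AAᴴ)² ≤ ‖A‖²_HS`: `‖AAᴴ e_j‖ ≤ ‖Aᴴ e_j‖` column by column.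
[folklore] -/
theorem re_trace_sq_mul_conjTranspose_le {A : Matrix m m ℂ}
    (hA : ∀ v : m → ℂ, ∑ i, ‖(A *ᵥ v) i‖ ^ 2 ≤ ∑ i, ‖v i‖ ^ 2) :
    Complex.re (((A * Aᴴ) * (A * Aᴴ)).trace) ≤ ∑ i, ∑ j, ‖A i j‖ ^ 2 := by
  have h1 : Complex.re (((A * Aᴴ) * (A * Aᴴ)).trace) =
      ∑ j, ∑ i, ‖((A * Aᴴ) *ᵥ Pi.single j 1) i‖ ^ 2 := by
    rw [re_trace_mul_self_of_isHermitian (isHermitian_mul_conjTranspose_self A),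
      sum_norm_sq_entries_eq_sum_mulVec_single]
  have h2 : ∑ i, ∑ j, ‖A i j‖ ^ 2 = ∑ j, ∑ i, ‖(Aᴴ *ᵥ Pi.single j 1) i‖ ^ 2 := by
    rw [← sum_norm_sq_entries_conjTranspose A, sum_norm_sq_entries_eq_sum_mulVec_single]
  rw [h1, h2]
  refine Finset.sum_le_sum fun j _ => ?_
  rw [← mulVec_mulVec]
  exact hA _

/-- `adj(A)ᴴ · adj(A) = adj(A · Aᴴ)`. [folklore] -/
theorem conjTranspose_adjugate_mul_adjugate (A : Matrix m m ℂ) :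
    A.adjugateᴴ * A.adjugate = (A * Aᴴ).adjugate := by
  rw [adjugate_conjTranspose, adjugate_mul_distrib]

/-- `‖adj(A) y‖² = re ⟨y, adj(AAᴴ) y⟩`. [folklore] -/
theorem sum_norm_sq_adjugate_mulVec (A : Matrix m m ℂ) (y : m → ℂ) :
    ∑ i, ‖(A.adjugate *ᵥ y) i‖ ^ 2 =
      Complex.re (star y ⬝ᵥ ((A * Aᴴ).adjugate *ᵥ y)) := by
  rw [sum_norm_sq_eq_re_dotProduct, star_mulVec, ← dotProduct_mulVec, mulVec_mulVec,
    conjTranspose_adjugate_mul_adjugate]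

/-- **Adjugate bound for a contraction.** If `‖A v‖ ≤ ‖v‖` for all `v` (Euclidean norms), then
`‖adj(A) y‖² ≤ e^{1/2} exp((‖A‖²_HS − N)/2) ‖y‖²`. [folklore] -/
theorem sum_norm_sq_adjugate_mulVec_le {A : Matrix m m ℂ}
    (hA : ∀ v : m → ℂ, ∑ i, ‖(A *ᵥ v) i‖ ^ 2 ≤ ∑ i, ‖v i‖ ^ 2) (y : m → ℂ) :
    ∑ i, ‖(A.adjugate *ᵥ y) i‖ ^ 2 ≤
      Real.exp (1 / 2) * Real.exp ((∑ i, ∑ j, ‖A i j‖ ^ 2 - Fintype.card m) / 2) *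
        ∑ i, ‖y i‖ ^ 2 := by
  have hH : (A * Aᴴ).IsHermitian := isHermitian_mul_conjTranspose_self A
  have hF := norm_star_dotProduct_adjugate_mulVec_le hH y y
  rw [← Real.sqrt_mul (Finset.sum_nonneg fun i _ => by positivity),
    Real.sqrt_mul_self (Finset.sum_nonneg fun i _ => by positivity)] at hF
  have htr := re_trace_sq_mul_conjTranspose_le hA
  calc ∑ i, ‖(A.adjugate *ᵥ y) i‖ ^ 2
      = Complex.re (star y ⬝ᵥ ((A * Aᴴ).adjugate *ᵥ y)) := sum_norm_sq_adjugate_mulVec A y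
    _ ≤ ‖star y ⬝ᵥ ((A * Aᴴ).adjugate *ᵥ y)‖ := Complex.re_le_norm _
    _ ≤ Real.exp (1 / 2) *
          Real.exp ((Complex.re ((A * Aᴴ) * (A * Aᴴ)).trace - Fintype.card m) / 2) *
          ∑ i, ‖y i‖ ^ 2 := hF
    _ ≤ Real.exp (1 / 2) * Real.exp ((∑ i, ∑ j, ‖A i j‖ ^ 2 - Fintype.card m) / 2) *
          ∑ i, ‖y i‖ ^ 2 := by
        gcongr

/-- **Operator bound for the adjugate of a contraction** (non-Hermitian Part F). If
`‖A v‖ ≤ ‖v‖` for all `v`, then for all vectors `x, y`: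
`|⟨x, adj(A) y⟩| ≤ e^{1/4} · exp((‖A‖²_HS − N)/4) · ‖x‖ ‖y‖`. For rods this turns Lenard's
cofactor formula into a Gaussian bound in the Hilbert–Schmidt deficiency `N − ‖A‖²_HS`.
[folklore] -/
theorem norm_star_dotProduct_adjugate_mulVec_le_of_contraction {A : Matrix m m ℂ}
    (hA : ∀ v : m → ℂ, ∑ i, ‖(A *ᵥ v) i‖ ^ 2 ≤ ∑ i, ‖v i‖ ^ 2) (x y : m → ℂ) :
    ‖star x ⬝ᵥ (A.adjugate *ᵥ y)‖ ≤
      Real.exp (1 / 4) * Real.exp ((∑ i, ∑ j, ‖A i j‖ ^ 2 - Fintype.card m) / 4) *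
        (Real.sqrt (∑ i, ‖x i‖ ^ 2) * Real.sqrt (∑ i, ‖y i‖ ^ 2)) := by
  set z := A.adjugate *ᵥ y with hz
  set F : ℝ := ∑ i, ∑ j, ‖A i j‖ ^ 2 with hFdef
  -- Cauchy–Schwarz
  have hCS : ‖star x ⬝ᵥ z‖ ≤ Real.sqrt (∑ i, ‖x i‖ ^ 2) * Real.sqrt (∑ i, ‖z i‖ ^ 2) := by
    calc ‖star x ⬝ᵥ z‖ = ‖∑ i, star (x i) * z i‖ := rfl
      _ ≤ ∑ i, ‖star (x i) * z i‖ := norm_sum_le _ _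
      _ = ∑ i, ‖x i‖ * ‖z i‖ := by
          refine Finset.sum_congr rfl fun i _ => ?_
          rw [norm_mul, norm_star]
      _ ≤ Real.sqrt (∑ i, ‖x i‖ ^ 2) * Real.sqrt (∑ i, ‖z i‖ ^ 2) :=
          Real.sum_mul_le_sqrt_mul_sqrt _ _ _
  -- the bound on `‖z‖`
  have hz2 : ∑ i, ‖z i‖ ^ 2 ≤
      Real.exp (1 / 2) * Real.exp ((F - Fintype.card m) / 2) * ∑ i, ‖y i‖ ^ 2 :=
    sum_norm_sq_adjugate_mulVec_le hA y
  have hsq : Real.exp (1 / 2) * Real.exp ((F - Fintype.card m) / 2) =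
      (Real.exp (1 / 4) * Real.exp ((F - Fintype.card m) / 4)) ^ 2 := by
    rw [mul_pow, ← Real.exp_nat_mul, ← Real.exp_nat_mul]
    congr 1 <;> congr 1 <;> push_cast <;> ring
  have hzle : Real.sqrt (∑ i, ‖z i‖ ^ 2) ≤
      Real.exp (1 / 4) * Real.exp ((F - Fintype.card m) / 4) * Real.sqrt (∑ i, ‖y i‖ ^ 2) := by
    rw [← Real.sqrt_sq (by positivity :
      (0 : ℝ) ≤ Real.exp (1 / 4) * Real.exp ((F - Fintype.card m) / 4)), ← Real.sqrt_mul (sq_nonneg _)]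
    exact Real.sqrt_le_sqrt (by rw [← hsq]; exact hz2)
  calc ‖star x ⬝ᵥ z‖ ≤ Real.sqrt (∑ i, ‖x i‖ ^ 2) * Real.sqrt (∑ i, ‖z i‖ ^ 2) := hCS
    _ ≤ Real.sqrt (∑ i, ‖x i‖ ^ 2) *
        (Real.exp (1 / 4) * Real.exp ((F - Fintype.card m) / 4) * Real.sqrt (∑ i, ‖y i‖ ^ 2)) :=
        mul_le_mul_of_nonneg_left hzle (Real.sqrt_nonneg _)
    _ = Real.exp (1 / 4) * Real.exp ((F - Fintype.card m) / 4) *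
        (Real.sqrt (∑ i, ‖x i‖ ^ 2) * Real.sqrt (∑ i, ‖y i‖ ^ 2)) := by ring

end AdjugateContraction

end Literature.Barriers.AtomisticToContinuum.BoseGas

end
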